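import Literature.Geometry.Manifold.SmoothPinchMap
import Literature.Geometry.Manifold.DeRhamFundamentalClassPairing
import Literature.Geometry.Symplectic.ComplexOrientationExists
import Literature.NumberTheory.Transcendental.FormIntegrationAddProofs
import HarnessLib

/-!
# The sign of `∫_N v` against the fundamental class of the orientation of `v` is universal (dim 4)

G. E. Bredon, *Topology and Geometry* (1993), VI.7 (Thm. 7.15 ff.) with V.9 (Thm. V.9.5, de Rham)
and V.6 (degree-one collapse `M → Sⁿ`); J. M. Lee, *Introduction to Smooth Manifolds* (2013),
Prop. 15.5, Prop. 16.6, Thm. 17.31, Thm. 18.14; J. Milnor, *Topology from the Differentiable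
Viewpoint* (1965), §4–§5.

For a closed connected `C^∞` `4`-manifold `N` and a nowhere-vanishing smooth `4`-form `v`, the tree
attaches to `v` a smooth orientation `o_v` (`smoothOrientationOfCoeff coeffFour … v`, the ray of
`v`) and to `o_v` a homological `ℤ`-orientation `μ_v = homologicalOrientationOfSmooth o_v`, whose
reference generator of `H₄(ℝ⁴ | 0; ℤ)` is a `Classical.choice` (`μE`); the de Rham/fundamental-class
pairing `P_N(v) = ⟨e_N[v], [N]_{μ_v} ⊗ 1⟩` (`periodFunctional`) is known to be NON-ZERO
(`periodFunctional_fundamentalClass_ne_zero`), but its sign is not decidable in the tree.  This file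
proves that the sign is nevertheless THE SAME for all `(N, v)`:

* `sphereBumpForm` — a smooth closed bump `4`-form on `S⁴` concentrated at the base point;
* `pullback_orientedPinch_sphereBumpForm_apply` — its pull-back along the oriented pinch map of
  `o_v` at `p` is the chart bump `φ(c x) · det(dc_x)` of the oriented unit chart `c`;
* `integral_pullback_sphereBumpForm_pos` — that pull-back has POSITIVE integral for the ray
  orientation of `v` (the unit chart is positively oriented along its whole ball: the coefficient of
  `v` read in one chart has constant sign on a convex set);
* `periodFunctional_mul_pos_of_integral_pos` — **`P_N(v)` and `P_N(β)` have the same sign for every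
  closed smooth `4`-form `β` with positive `o_v`-integral** (`H⁴(N; ℝ)` is detected by `[N]`, so
  `[β] = λ [v]` with `λ = ∫β / ∫v > 0` by Stokes);
* `periodFunctional_pullback_eq` — `P_N(f^*β_S) = ⟨e_S[β_S], f_*[N] ⊗ 1⟩` (naturality of de Rham's
  isomorphism and the Kronecker adjunction);
* **`rayPeriod_mul_rayPeriod_pos`** — for any two such pairs `(N, v)`, `(N', v')`,
  `0 < P_N(v) · P_{N'}(v')`: `f_*[N]_{μ_v} ∈ H₄(S⁴; ℤ)` does not depend on `(N, v)`
  (`map_orientedPinch_fundamentalClass_eq`, the oriented pinch map has degree one);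
* `deRhamSignFour`, **`deRhamSignFour_mul_rayPeriod_pos`** — hence a universal sign `ε_dR = ±1`
  with `0 < ε_dR · P_N(v)` for all `(N, v)` (`rayPeriod v hv hne = P_N(v)`, `rayOrientation`,
  `rayHomologicalOrientation`; for a `J`-positive `v` the ray orientation is the tree's
  `J.smoothOrientationOfPositiveTopForm v`, `rayOrientation_eq_smoothOrientationOfPositiveTopForm`).

Everything is proved; no named facts.

## References

* [Bredon1993] G. E. Bredon, Topology and Geometry, GTM 139, Springer 1993, V.6, V.9.5, VI.7.
* [LeeSmoothManifolds2013] J. M. Lee, Introduction to Smooth Manifolds, 2nd ed., GTM 218, 2013,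
  Prop. 15.5, Prop. 16.6, Thm. 17.31, Thm. 18.14.
* [MilnorTDV1965] J. Milnor, Topology from the Differentiable Viewpoint, 1965, §4–§5.
-/

noncomputable section

open scoped Manifold ContDiff Topology
open Set Metric Module Function Filter
open Literature.AlgebraicTopology.SingularHomology Literature.Geometry.Kaehler Literature.Geometry.Symplectic
open Literature.Topology.FourManifolds Literature.Topology.FourManifolds.HomologicalOrientationOfSmooth
open Literature.NumberTheory.Transcendental

namespace Literature.Geometry.Manifold

open SmoothPinch

namespace DeRhamSignFour

/-! ### The bump form on `S⁴` -/

section SphereForm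

/-- The bump coefficient `φ`: `≡ 1` on `B̄(0, ⅛)`, supported in `B(0, ¼)`, values in `[0, 1]`. [folklore] -/
def bumpQ : ContDiffBump (0 : EuclideanSpace ℝ (Fin 4)) := ⟨1 / 8, 1 / 4, by norm_num, by norm_num⟩

/-- `φ(0) = 1 > 0`. [folklore] -/
theorem bumpQ_zero : bumpQ 0 = 1 := bumpQ.one_of_mem_closedBall (mem_closedBall_self bumpQ.rIn_pos.le)

/-- `φ` vanishes off `B(0, ¼)`. [folklore] -/
theorem bumpQ_eq_zero {y : EuclideanSpace ℝ (Fin 4)} (hy : 1 / 4 ≤ ‖y‖) : bumpQ y = 0 :=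
  bumpQ.zero_of_le_dist (by rwa [dist_zero_right])

/-- `φ ≥ 0`. [folklore] -/
theorem bumpQ_nonneg (y : EuclideanSpace ℝ (Fin 4)) : 0 ≤ bumpQ y := bumpQ.nonneg

/-- **The model bump form** `β̂ = φ · vol` on `ℝ⁴` (`vol` the tree's `modelVolumeForm`). [folklore] -/
def modelBumpForm : MForm (𝓡 4) (EuclideanSpace ℝ (Fin 4)) ℝ 4 := fun y ↦ bumpQ y • modelVolumeForm

/-- Values of the model bump form. [folklore] -/
theorem modelBumpForm_apply (y : EuclideanSpace ℝ (Fin 4)) (w : Fin 4 → EuclideanSpace ℝ (Fin 4)) :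
    modelBumpForm y w = bumpQ y * modelVolumeForm w := rfl

/-- The model bump form vanishes off `B(0, ¼)`. [folklore] -/
theorem modelBumpForm_eq_zero {y : EuclideanSpace ℝ (Fin 4)} (hy : 1 / 4 ≤ ‖y‖) : modelBumpForm y = 0 := by
  ext w
  rw [modelBumpForm_apply, bumpQ_eq_zero hy, zero_mul, ContinuousAlternatingMap.coe_zero, Pi.zero_apply]

/-- The model bump form is smooth. [folklore] -/
theorem isSmoothForm_modelBumpForm : IsSmoothForm modelBumpForm := by
  rw [isSmoothForm_iff_smoothAt]
  intro y
  have h : modelBumpForm = (fun y : EuclideanSpace ℝ (Fin 4) ↦ (bumpQ y : ℝ)) • constModelForm modelVolumeForm := rfl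
  rw [h]
  exact MForm.SmoothAt.fun_smul (bumpQ.contDiff.contMDiff.contMDiffAt) (smoothAt_constModelForm _ _)

/-- `vol(e₀, …, e₃) = 1` on the standard basis. [folklore] -/
theorem modelVolumeForm_basisFun : modelVolumeForm ⇑(EuclideanSpace.basisFun (Fin 4) ℝ) = 1 := by
  have h := Orientation.volumeForm_robust ((EuclideanSpace.basisFun (Fin 4) ℝ).toBasis.orientation)
    (EuclideanSpace.basisFun (Fin 4) ℝ) rfl
  change ((EuclideanSpace.basisFun (Fin 4) ℝ).toBasis.orientation).volumeFormL ⇑(EuclideanSpace.basisFun (Fin 4) ℝ) = 1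
  rw [Orientation.volumeFormL_apply]  -- hmm: volumeFormL v = volumeForm v?
  rw [h, ← OrthonormalBasis.coe_toBasis, Basis.det_self]

/-- `vol(A e₀, …, A e₃) = det A`. [folklore] -/
theorem modelVolumeForm_comp (A : EuclideanSpace ℝ (Fin 4) →L[ℝ] EuclideanSpace ℝ (Fin 4)) :
    modelVolumeForm (fun i ↦ A (EuclideanSpace.basisFun (Fin 4) ℝ i)) =
      LinearMap.det (A : EuclideanSpace ℝ (Fin 4) →ₗ[ℝ] EuclideanSpace ℝ (Fin 4)) := by
  rw [ContinuousAlternatingMap.apply_comp_eq_det_mul (EuclideanSpace.basisFun (Fin 4) ℝ).toBasis modelVolumeForm A,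
    modelVolumeForm_basisFun, mul_one]

open Classical in
/-- **The bump form on `S⁴`**: the pull-back of the model bump form along the stereographic chart
from the pole, extended by zero at the pole. [folklore] -/
def sphereBumpForm : MForm (𝓡 4) (sphere (0 : EuclideanSpace ℝ (Fin 5)) 1) ℝ 4 := fun q ↦
  if q ∈ (stereo 4).source then (modelBumpForm.pullback (𝓡 4) (stereo 4)) q else 0

/-- The sphere bump form on the chart source. [folklore] -/
theorem sphereBumpForm_of_mem {q : sphere (0 : EuclideanSpace ℝ (Fin 5)) 1} (hq : q ∈ (stereo 4).source) :
    sphereBumpForm q = (modelBumpForm.pullback (𝓡 4) (stereo 4)) q := by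
  classical
  unfold sphereBumpForm
  exact if_pos hq

/-- The compact set `σ⁻¹(B̄(0, ¼))` carrying the sphere bump form. [folklore] -/
def bumpCarrier : Set (sphere (0 : EuclideanSpace ℝ (Fin 5)) 1) :=
  (stereo 4).symm '' closedBall (0 : EuclideanSpace ℝ (Fin 4)) (1 / 4)

/-- The carrier is compact. [folklore] -/
theorem isCompact_bumpCarrier : IsCompact bumpCarrier :=
  (isCompact_closedBall _ _).image_of_continuousOn ((stereo 4).continuousOn_symm.mono fun y _ ↦ by
    rw [stereo_target]; exact mem_univ _)

/-- Off the carrier the sphere bump form vanishes. [folklore] -/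
theorem sphereBumpForm_eq_zero_of_not_mem {q : sphere (0 : EuclideanSpace ℝ (Fin 5)) 1} (hq : q ∉ bumpCarrier) :
    sphereBumpForm q = 0 := by
  by_cases hs : q ∈ (stereo 4).source
  · rw [sphereBumpForm_of_mem hs]
    have h1 : 1 / 4 ≤ ‖stereo 4 q‖ := by
      by_contra hlt
      push Not at hlt
      exact hq ⟨stereo 4 q, mem_closedBall_zero_iff.2 hlt.le, (stereo 4).left_inv hs⟩
    ext w
    simp [MForm.pullback_apply, modelBumpForm_eq_zero h1]
  · classical
    unfold sphereBumpForm
    exact if_neg hs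

/-- The stereographic chart is `C^∞` at every point of its source. [folklore] -/
theorem contMDiffAt_stereo {q : sphere (0 : EuclideanSpace ℝ (Fin 5)) 1} (hq : q ∈ (stereo 4).source) :
    ContMDiffAt (𝓡 4) (𝓡 4) ∞ (stereo 4) q :=
  (contMDiffOn_of_mem_maximalAtlas (IsManifold.subset_maximalAtlas (stereo_mem_atlas 4))).contMDiffAt
    ((stereo 4).open_source.mem_nhds hq)

/-- **The sphere bump form is smooth.** [folklore] -/
theorem isSmoothForm_sphereBumpForm : IsSmoothForm sphereBumpForm := by
  rw [isSmoothForm_iff_smoothAt]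
  intro q
  by_cases hq : q ∈ (stereo 4).source
  · have h1 : (modelBumpForm.pullback (𝓡 4) (stereo 4)).SmoothAt q := by
      refine MForm.SmoothAt.pullback ?_ ((isSmoothForm_iff_smoothAt _).1 isSmoothForm_modelBumpForm _)
      filter_upwards [(stereo 4).open_source.mem_nhds hq] with z hz
      exact contMDiffAt_stereo hz
    refine h1.congr_of_eventuallyEq ?_
    filter_upwards [(stereo 4).open_source.mem_nhds hq] with z hz
    exact (sphereBumpForm_of_mem hz).symm
  · have hqK : q ∉ bumpCarrier := by
      rintro ⟨y, _, rfl⟩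
      exact hq ((stereo 4).map_target (by rw [stereo_target]; exact mem_univ _))
    refine (MForm.smoothAt_zero q).congr_of_eventuallyEq ?_
    filter_upwards [isCompact_bumpCarrier.isClosed.isOpen_compl.mem_nhds hqK] with z hz
    exact (sphereBumpForm_eq_zero_of_not_mem hz).symm

/-- The sphere bump form is closed (a top form). [folklore] -/
theorem isClosedForm_sphereBumpForm : IsClosedForm sphereBumpForm := isClosedForm_four _

end SphereForm


/-! ### Model-space bookkeeping in dimension four -/

section Model

/-- `extChartAt = chartAt` as functions, for manifolds charted on the model vector space. [folklore] -/
theorem extChartAt_coe_eq {N : Type} [TopologicalSpace N] [ChartedSpace (EuclideanSpace ℝ (Fin 4)) N] (p : N) :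
    ⇑(extChartAt (𝓡 4) p) = chartAt (EuclideanSpace ℝ (Fin 4)) p := by
  rw [extChartAt_coe]
  rfl

/-- `extChartAt` and `chartAt` have the same target, for manifolds charted on the model vector space.
[folklore] -/
theorem extChartAt_target_eq {N : Type} [TopologicalSpace N] [ChartedSpace (EuclideanSpace ℝ (Fin 4)) N] (p : N) :
    (extChartAt (𝓡 4) p).target = (chartAt (EuclideanSpace ℝ (Fin 4)) p).target := by
  rw [extChartAt_target]
  change id ⁻¹' (chartAt (EuclideanSpace ℝ (Fin 4)) p).target ∩ range id = _
  rw [preimage_id_eq, id, range_id, inter_univ]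

/-- The standard basis of `ℝ⁴` as a `Basis`. [folklore] -/
abbrev bfB : Basis (Fin 4) ℝ (EuclideanSpace ℝ (Fin 4)) := (EuclideanSpace.basisFun (Fin 4) ℝ).toBasis

/-- The standard basis of `ℝ⁴` as a function. [folklore] -/
theorem coe_bfB : (⇑bfB : Fin 4 → EuclideanSpace ℝ (Fin 4)) = ⇑(EuclideanSpace.basisFun (Fin 4) ℝ) :=
  OrthonormalBasis.coe_toBasis _

/-- A top form on `ℝ⁴` is its standard coefficient times the standard determinant:
`w(u) = w(e) · det_e(u)`. [folklore] -/
theorem apply_eq_coeffFour_mul (w : (EuclideanSpace ℝ (Fin 4)) [⋀^Fin 4]→L[ℝ] ℝ) (u : Fin 4 → EuclideanSpace ℝ (Fin 4)) :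
    w u = AlmostComplexStructure.coeffFour w * bfB.det u := by
  have h1 := w.toAlternatingMap.eq_smul_basis_det bfB
  have h2 := congrArg (fun f : (EuclideanSpace ℝ (Fin 4)) [⋀^Fin 4]→ₗ[ℝ] ℝ ↦ f u) h1
  simp only [AlternatingMap.smul_apply, smul_eq_mul, ContinuousAlternatingMap.coe_toAlternatingMap] at h2
  rw [h2, AlmostComplexStructure.coeffFour, coe_bfB]

/-- `vol(u) = det_e(u)`. [folklore] -/
theorem modelVolumeForm_eq_det (u : Fin 4 → EuclideanSpace ℝ (Fin 4)) : modelVolumeForm u = bfB.det u := by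
  rw [apply_eq_coeffFour_mul, AlmostComplexStructure.coeffFour, modelVolumeForm_basisFun, one_mul]

/-- The standard determinant of the reference frame `modelBasis` of the integration theory is
non-zero. [folklore] -/
theorem det_modelBasis_ne_zero : bfB.det ⇑(modelBasis (EuclideanSpace ℝ (Fin 4)) 4) ≠ 0 :=
  ((Module.Basis.is_basis_iff_det bfB).1 ⟨(modelBasis (EuclideanSpace ℝ (Fin 4)) 4).linearIndependent,
    (modelBasis (EuclideanSpace ℝ (Fin 4)) 4).span_eq⟩).ne_zero

/-- A top form non-zero as a map is non-zero on the standard frame. [folklore] -/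
theorem coeffFour_ne_zero_of_ne_zero {w : (EuclideanSpace ℝ (Fin 4)) [⋀^Fin 4]→L[ℝ] ℝ} (hw : w ≠ 0) :
    AlmostComplexStructure.coeffFour w ≠ 0 := fun h ↦
  hw (eq_zero_of_apply_basis_eq_zero w bfB (by rw [coe_bfB]; exact h))

end Model

/-! ### The ray orientation of a nowhere-vanishing `4`-form and its period -/

section Ray

variable {N : Type} [TopologicalSpace N] [ChartedSpace (EuclideanSpace ℝ (Fin 4)) N] [IsManifold (𝓡 4) ∞ N]

/-- **The ray orientation of a nowhere-vanishing `4`-form**: `y ↦ sign v_y(e₀, …, e₃) · [e₀, …, e₃]`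
(the tree's `smoothOrientationOfCoeff` for the standard coefficient; for a `J`-positive form this IS
`J.smoothOrientationOfPositiveTopForm v`, `rayOrientation_eq_smoothOrientationOfPositiveTopForm`).
[cite: LeeSmoothManifolds2013, Prop. 15.5] -/
def rayOrientation (v : MForm (𝓡 4) N ℝ 4) (hv : IsSmoothForm v) (hne : ∀ x, v x ≠ 0) : SmoothOrientation (𝓡 4) N :=
  smoothOrientationOfCoeff AlmostComplexStructure.coeffFour AlmostComplexStructure.continuous_coeffFour
    AlmostComplexStructure.coeffFour_compContinuousLinearMap v hv fun y ↦ coeffFour_ne_zero_of_ne_zero (hne y)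

/-- Values of the ray orientation. [folklore] -/
theorem rayOrientation_apply (v : MForm (𝓡 4) N ℝ 4) (hv : IsSmoothForm v) (hne : ∀ x, v x ≠ 0) (y : N) :
    rayOrientation v hv hne y = signOrientationIn 4 (AlmostComplexStructure.coeffFour (v y)) := rfl

/-- For a `J`-positive form the ray orientation is the tree's `smoothOrientationOfPositiveTopForm`.
[folklore] -/
theorem rayOrientation_eq_smoothOrientationOfPositiveTopForm (J : AlmostComplexStructure (𝓡 4) ∞ N) (v : MForm (𝓡 4) N ℝ 4)
    (hv : IsSmoothForm v) (hJv : J.IsPositiveTopForm v) :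
    rayOrientation v hv hJv.apply_ne_zero = J.smoothOrientationOfPositiveTopForm v hv hJv := rfl

/-- **The ray `ℤ`-orientation** of a nowhere-vanishing `4`-form: the homological orientation attached
to its ray orientation. [cite: Bredon1993, VI.7 Thm. 7.15] -/
def rayHomologicalOrientation [T2Space N] (v : MForm (𝓡 4) N ℝ 4) (hv : IsSmoothForm v) (hne : ∀ x, v x ≠ 0) :
    HomologicalOrientation ℤ N 4 :=
  homologicalOrientationOfSmooth (rayOrientation v hv hne)

/-- **The period of `v` on its own orientation**: `P_N(v) = ⟨e_N[v], [N]_{μ_v} ⊗ 1⟩`. [cite: Bredon1993, Thm. V.9.5] -/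
def rayPeriod [T2Space N] [SigmaCompactSpace N] (v : MForm (𝓡 4) N ℝ 4) (hv : IsSmoothForm v) (hne : ∀ x, v x ≠ 0) : ℝ :=
  periodFunctional v hv (isClosedForm_four v) (rayHomologicalOrientation v hv hne).fundamentalClass

/-- The period of `v` on its own orientation is non-zero (closed connected `N`). [cite: Bredon1993, Thm. V.9.5] -/
theorem rayPeriod_ne_zero [T2Space N] [CompactSpace N] [ConnectedSpace N] (v : MForm (𝓡 4) N ℝ 4) (hv : IsSmoothForm v)
    (hne : ∀ x, v x ≠ 0) : rayPeriod v hv hne ≠ 0 :=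
  AlmostComplexStructure.periodFunctional_fundamentalClass_ne_zero _ hv (isClosedForm_four v) hne

end Ray

/-! ### The oriented unit chart is positively oriented along its whole ball -/

section Chart

variable {N : Type} [TopologicalSpace N] [ChartedSpace (EuclideanSpace ℝ (Fin 4)) N] [IsManifold (𝓡 4) ∞ N]
  (o : SmoothOrientation (𝓡 4) N) (p : N)

/-- The derivative of the normaliser is its linear part `s⁻¹ R`. [folklore] -/
theorem hasFDerivAt_normaliser (y : EuclideanSpace ℝ (Fin 4)) :
    HasFDerivAt (normaliser o p) ((invScale o p)⁻¹ • Rl o p) y := by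
  have h : (normaliser o p : EuclideanSpace ℝ (Fin 4) → EuclideanSpace ℝ (Fin 4)) = fun z ↦
      (invScale o p)⁻¹ • (Rl o p z - Rl o p (chartAt (EuclideanSpace ℝ (Fin 4)) p p)) := funext (normaliser_apply o p)
  rw [h]
  exact ((Rl o p).hasFDerivAt.sub_const _).const_smul ((invScale o p)⁻¹)

/-- **The differential of the unit chart**: `dc_x = s⁻¹ R ∘ D(c_p ∘ c_x⁻¹)(c_x x)` on the chart source.
[folklore] -/
theorem mfderiv_unitChart {x : N} (hx : x ∈ (chartAt (EuclideanSpace ℝ (Fin 4)) p).source) :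
    mfderiv (𝓡 4) (𝓡 4) (unitChart o p) x = ((invScale o p)⁻¹ • Rl o p).comp (tangentCoordChange (𝓡 4) x p x) := by
  have h1 : (unitChart o p : N → EuclideanSpace ℝ (Fin 4)) = normaliser o p ∘ chartAt (EuclideanSpace ℝ (Fin 4)) p := rfl
  have hn : HasMFDerivAt 𝓘(ℝ, EuclideanSpace ℝ (Fin 4)) 𝓘(ℝ, EuclideanSpace ℝ (Fin 4)) (normaliser o p)
      (chartAt (EuclideanSpace ℝ (Fin 4)) p x) ((invScale o p)⁻¹ • Rl o p) :=
    hasMFDerivAt_iff_hasFDerivAt.2 (hasFDerivAt_normaliser o p _)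
  rw [h1, mfderiv_comp x hn.mdifferentiableAt (mdifferentiableAt_atlas (chart_mem_atlas _ p) hx), hn.mfderiv,
    mfderiv_chartAt_eq_tangentCoordChange hx]
  rfl

/-- The determinant of an endomorphism of `ℝ⁴` given as a continuous linear map. [folklore] -/
abbrev detE (A : EuclideanSpace ℝ (Fin 4) →L[ℝ] EuclideanSpace ℝ (Fin 4)) : ℝ :=
  LinearMap.det (A : EuclideanSpace ℝ (Fin 4) →ₗ[ℝ] EuclideanSpace ℝ (Fin 4))

open Classical in
/-- `det R = ±1` according as the preferred chart at `p` is positively oriented or not. [folklore] -/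
theorem det_Rl : LinearMap.det (Rl o p : EuclideanSpace ℝ (Fin 4) →ₗ[ℝ] EuclideanSpace ℝ (Fin 4)) =
    if o p = euclideanOrientation 4 then 1 else -1 := by
  unfold Rl
  split_ifs
  · rw [ContinuousLinearMap.coe_id, LinearMap.det_id]
  · exact det_reflE (n := 4) four_pos

open Classical in
/-- **The determinant of the differential of the unit chart.** [folklore] -/
theorem det_mfderiv_unitChart {x : N} (hx : x ∈ (chartAt (EuclideanSpace ℝ (Fin 4)) p).source) :
    detE (mfderiv (𝓡 4) (𝓡 4) (unitChart o p) x) =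
      ((invScale o p)⁻¹) ^ Module.finrank ℝ (EuclideanSpace ℝ (Fin 4)) * (if o p = euclideanOrientation 4 then 1 else -1) *
        detE (tangentCoordChange (𝓡 4) x p x) := by
  rw [mfderiv_unitChart o p hx]
  change LinearMap.det (((invScale o p)⁻¹ • (Rl o p : EuclideanSpace ℝ (Fin 4) →ₗ[ℝ] EuclideanSpace ℝ (Fin 4))) ∘ₗ
    ((tangentCoordChange (𝓡 4) x p x : EuclideanSpace ℝ (Fin 4) →L[ℝ] EuclideanSpace ℝ (Fin 4)) :
      EuclideanSpace ℝ (Fin 4) →ₗ[ℝ] EuclideanSpace ℝ (Fin 4))) = _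
  rw [LinearMap.det_comp, LinearMap.det_smul, det_Rl]

/-- The inverse normaliser maps the closed unit ball into the target of the preferred chart. [folklore] -/
theorem normaliser_symm_mem_target {z : EuclideanSpace ℝ (Fin 4)} (hz : ‖z‖ ≤ 1) :
    (normaliser o p).symm z ∈ (chartAt (EuclideanSpace ℝ (Fin 4)) p).target := by
  have h := closedBall_subset_unitChart_target o p (mem_closedBall_zero_iff.2 hz)
  rw [unitChart, OpenPartialHomeomorph.trans_target] at h
  exact h.2

/-- **The ball of the unit chart, read in the preferred chart**: `S = {y | ‖D y‖ < 1}`. [folklore] -/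
def chartBallSet : Set (EuclideanSpace ℝ (Fin 4)) := {y | ‖normaliser o p y‖ < 1}

/-- Membership in the chart ball. [folklore] -/
theorem mem_chartBallSet {y : EuclideanSpace ℝ (Fin 4)} : y ∈ chartBallSet o p ↔ ‖normaliser o p y‖ < 1 := Iff.rfl

/-- The ball lies in the target of the preferred chart. [folklore] -/
theorem chartBallSet_subset_target : chartBallSet o p ⊆ (chartAt (EuclideanSpace ℝ (Fin 4)) p).target := fun y hy ↦ by
  have h := normaliser_symm_mem_target o p (le_of_lt hy)
  rwa [Homeomorph.symm_apply_apply] at h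

/-- The centre lies in the ball. [folklore] -/
theorem self_mem_chartBallSet : chartAt (EuclideanSpace ℝ (Fin 4)) p p ∈ chartBallSet o p := by
  rw [mem_chartBallSet, ← unitChart_apply, unitChart_self, norm_zero]
  exact one_pos

/-- The ball is convex (the normaliser is affine). [folklore] -/
theorem convex_chartBallSet : Convex ℝ (chartBallSet o p) := by
  intro y₁ hy₁ y₂ hy₂ a b ha hb hab
  rw [mem_chartBallSet] at hy₁ hy₂ ⊢
  have h : normaliser o p (a • y₁ + b • y₂) = a • normaliser o p y₁ + b • normaliser o p y₂ := by
    obtain rfl : b = 1 - a := by linarith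
    simp only [normaliser_apply, map_add, map_smul, smul_sub]
    module
  rw [h]
  calc ‖a • normaliser o p y₁ + b • normaliser o p y₂‖ ≤ ‖a • normaliser o p y₁‖ + ‖b • normaliser o p y₂‖ := norm_add_le _ _
    _ = a * ‖normaliser o p y₁‖ + b * ‖normaliser o p y₂‖ := by
        rw [norm_smul, norm_smul, Real.norm_eq_abs, Real.norm_eq_abs, abs_of_nonneg ha, abs_of_nonneg hb]
    _ < 1 := by
        rcases ha.eq_or_lt with rfl | ha'
        · rw [zero_add] at hab
          rw [hab, zero_mul, one_mul, zero_add]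
          exact hy₂
        · calc a * ‖normaliser o p y₁‖ + b * ‖normaliser o p y₂‖ < a * 1 + b * 1 :=
              add_lt_add_of_lt_of_le (mul_lt_mul_of_pos_left hy₁ ha') (mul_le_mul_of_nonneg_left hy₂.le hb)
            _ = 1 := by rw [mul_one, mul_one, hab]

variable {v : MForm (𝓡 4) N ℝ 4} (hv : IsSmoothForm v) (hne : ∀ x, v x ≠ 0)

include hv hne in
/-- **The coefficient of `v` read in ONE chart has constant sign on the convex chart ball**
(continuity, non-vanishing, intermediate values). [cite: LeeSmoothManifolds2013, Prop. 15.5] -/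
theorem coeffFour_inChart_pos_iff {y : EuclideanSpace ℝ (Fin 4)} (hy : y ∈ chartBallSet o p) :
    0 < AlmostComplexStructure.coeffFour (v.inChart p y) ↔ 0 < AlmostComplexStructure.coeffFour (v p) := by
  set g : EuclideanSpace ℝ (Fin 4) → ℝ := fun y ↦ AlmostComplexStructure.coeffFour (v.inChart p y) with hg
  -- continuity on the chart target
  have hcont : ContinuousOn g (chartAt (EuclideanSpace ℝ (Fin 4)) p).target := by
    have h1 := hv.continuousOn_inChart_apply_modelBasis (I := 𝓡 4) p
    rw [extChartAt_target_eq] at h1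
    have h2 : g = fun y ↦ (v.inChart p y) ⇑(modelBasis (EuclideanSpace ℝ (Fin 4)) 4) *
        ((modelBasis (EuclideanSpace ℝ (Fin 4)) 4).det ⇑bfB) := by
      funext y
      have h3 := (v.inChart p y).toAlternatingMap.eq_smul_basis_det (modelBasis (EuclideanSpace ℝ (Fin 4)) 4)
      have h4 := congrArg (fun f : (EuclideanSpace ℝ (Fin 4)) [⋀^Fin 4]→ₗ[ℝ] ℝ ↦ f ⇑bfB) h3
      simp only [AlternatingMap.smul_apply, smul_eq_mul, ContinuousAlternatingMap.coe_toAlternatingMap] at h4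
      rw [hg]
      dsimp only
      rw [AlmostComplexStructure.coeffFour, ← coe_bfB, h4]
    rw [h2]
    exact h1.mul continuousOn_const
  -- non-vanishing on the chart target
  have hnz : ∀ y ∈ (chartAt (EuclideanSpace ℝ (Fin 4)) p).target, g y ≠ 0 := by
    intro y hy
    set x := (chartAt (EuclideanSpace ℝ (Fin 4)) p).symm y with hx
    have hxs : x ∈ (chartAt (EuclideanSpace ℝ (Fin 4)) p).source := (chartAt _ p).map_target hy
    have hyx : y = extChartAt (𝓡 4) p x := by rw [extChartAt_coe_eq, hx, (chartAt _ p).right_inv hy]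
    have hxs' : x ∈ (extChartAt (𝓡 4) p).source := by rwa [extChartAt_source]
    rw [hg]
    dsimp only
    rw [hyx, coeff_inChart_extChartAt AlmostComplexStructure.coeffFour AlmostComplexStructure.coeffFour_compContinuousLinearMap v hxs']
    refine mul_ne_zero ?_ (coeffFour_ne_zero_of_ne_zero (hne x))
    have hd := det_tangentCoordChange_mul (n := 4) hxs
    exact right_ne_zero_of_mul_eq_one hd
  -- the centre
  have h0 : g (chartAt (EuclideanSpace ℝ (Fin 4)) p p) = AlmostComplexStructure.coeffFour (v p) := by
    rw [hg]
    dsimp only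
    rw [← extChartAt_coe_eq, MForm.inChart_apply_self]
  -- intermediate values on the convex ball
  have hS := convex_chartBallSet o p
  have hsub := chartBallSet_subset_target o p
  have hpS := self_mem_chartBallSet o p
  have key : ∀ {a b : EuclideanSpace ℝ (Fin 4)}, a ∈ chartBallSet o p → b ∈ chartBallSet o p → 0 < g a → 0 < g b := by
    intro a b ha hb hga
    by_contra hgb
    push Not at hgb
    have hmem : (0 : ℝ) ∈ Icc (g b) (g a) := ⟨hgb, hga.le⟩
    obtain ⟨c, hc, hgc⟩ := hS.isPreconnected.intermediate_value hb ha (hcont.mono hsub) hmem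
    exact hnz c (hsub hc) hgc
  rw [← h0]
  exact ⟨key hy hpS, key hpS hy⟩

/-- **The unit chart of the ray orientation is positively oriented along its whole ball**: for `x`
in the chart source with `‖c x‖ < 1`, `sign v_x(e) · det(dc_x) > 0`.
[cite: LeeSmoothManifolds2013, Prop. 15.5 and Prop. 15.6] -/
theorem coeffFour_mul_det_mfderiv_unitChart_pos {x : N} (hx : x ∈ (chartAt (EuclideanSpace ℝ (Fin 4)) p).source)
    (hcx : ‖unitChart (rayOrientation v hv hne) p x‖ < 1) :
    0 < AlmostComplexStructure.coeffFour (v x) * detE (mfderiv (𝓡 4) (𝓡 4) (unitChart (rayOrientation v hv hne) p) x) := by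
  classical
  set o := rayOrientation v hv hne with ho
  set a := AlmostComplexStructure.coeffFour (v p) with ha
  set b := AlmostComplexStructure.coeffFour (v x) with hb
  have ha0 : a ≠ 0 := coeffFour_ne_zero_of_ne_zero (hne p)
  have hb0 : b ≠ 0 := coeffFour_ne_zero_of_ne_zero (hne x)
  set d₁ := detE (tangentCoordChange (𝓡 4) p x x) with hd₁
  set d₂ := detE (tangentCoordChange (𝓡 4) x p x) with hd₂
  have hdd : d₂ * d₁ = 1 := det_tangentCoordChange_mul (n := 4) hx
  -- the sign relation from the one-chart coefficient
  have hy : chartAt (EuclideanSpace ℝ (Fin 4)) p x ∈ chartBallSet o p := hcx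
  have hg := coeffFour_inChart_pos_iff o p hv hne hy
  have hxs' : x ∈ (extChartAt (𝓡 4) p).source := by rwa [extChartAt_source]
  rw [← extChartAt_coe_eq, coeff_inChart_extChartAt AlmostComplexStructure.coeffFour
    AlmostComplexStructure.coeffFour_compContinuousLinearMap v hxs'] at hg
  -- `hg : 0 < d₁ * b ↔ 0 < a`
  have hR : (if o p = euclideanOrientation 4 then (1 : ℝ) else -1) = if 0 < a then 1 else -1 := by
    have h1 : o p = signOrientationIn 4 a := rfl
    by_cases ha' : 0 < a
    · have h2 : o p = euclideanOrientation 4 := by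
        rw [h1]
        show (if 0 < a then euclideanOrientation 4 else -euclideanOrientation 4) = _
        rw [if_pos ha']
      rw [if_pos h2, if_pos ha']
    · have h2 : o p ≠ euclideanOrientation 4 := by
        rw [h1]
        show (if 0 < a then euclideanOrientation 4 else -euclideanOrientation 4) ≠ _
        rw [if_neg ha']
        exact (Module.Ray.ne_neg_self _).symm
      rw [if_neg h2, if_neg ha']
  rw [det_mfderiv_unitChart o p hx, hR]
  have hs : 0 < ((invScale o p)⁻¹) ^ Module.finrank ℝ (EuclideanSpace ℝ (Fin 4)) := pow_pos (inv_pos.2 (invScale_pos o p)) _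
  -- sign bookkeeping
  have hd₂ : d₂ = d₁⁻¹ := eq_inv_of_mul_eq_one_left hdd
  have hd₁0 : d₁ ≠ 0 := right_ne_zero_of_mul_eq_one hdd
  rcases lt_or_gt_of_ne ha0 with ha' | ha'
  · rw [if_neg (not_lt.2 ha'.le)]
    have h1 : ¬ 0 < d₁ * b := fun h ↦ absurd (hg.1 h) (not_lt.2 ha'.le)
    have h2 : d₁ * b < 0 := lt_of_le_of_ne (not_lt.1 h1) (mul_ne_zero hd₁0 hb0)
    have h3 : b * d₂ < 0 := by
      rw [hd₂]
      rcases lt_or_gt_of_ne hd₁0 with hd | hd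
      · have : 0 < b := by nlinarith
        exact mul_neg_of_pos_of_neg this (inv_lt_zero.2 hd)
      · have : b < 0 := by nlinarith
        exact mul_neg_of_neg_of_pos this (inv_pos.2 hd)
    nlinarith
  · rw [if_pos ha']
    have h2 : 0 < d₁ * b := hg.2 ha'
    have h3 : 0 < b * d₂ := by
      rw [hd₂]
      rcases lt_or_gt_of_ne hd₁0 with hd | hd
      · have : b < 0 := by nlinarith
        exact mul_pos_of_neg_of_neg this (inv_lt_zero.2 hd)
      · have : 0 < b := by nlinarith
        exact mul_pos this (inv_pos.2 hd)
    nlinarith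

end Chart


/-! ### The pull-back of the sphere bump form along the oriented pinch map -/

section Pullback

variable {N : Type} [TopologicalSpace N] [ChartedSpace (EuclideanSpace ℝ (Fin 4)) N] [IsManifold (𝓡 4) ∞ N]
  (o : SmoothOrientation (𝓡 4) N) (p : N)

/-- `S⁴` is a `C^∞` manifold (it is analytic). [folklore] -/
instance instIsManifoldSphereFourInfty : IsManifold (𝓡 4) ∞ (sphere (0 : EuclideanSpace ℝ (Fin 5)) 1) :=
  IsManifold.of_le (n := ω) le_top

/-- **The pull-back of the sphere bump form near `p` is the chart bump**:
`(f^*β_S)_x(w) = φ(c x) · det(dc_x) · det_e(w)` for `x` in the chart source with `‖c x‖ < ½` (there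
`f = σ⁻¹ ∘ c`, `β_S = σ^*β̂`, and `dσ ∘ dσ⁻¹ = id`). [cite: LeeSmoothManifolds2013, Prop. 16.6] -/
theorem pullback_orientedPinch_sphereBumpForm_apply {x : N} (hx : x ∈ (chartAt (EuclideanSpace ℝ (Fin 4)) p).source)
    (hcx : ‖unitChart o p x‖ < 1 / 2) (w : Fin 4 → EuclideanSpace ℝ (Fin 4)) :
    (sphereBumpForm.pullback (𝓡 4) (orientedPinch o p)) x w =
      bumpQ (unitChart o p x) * (detE (mfderiv (𝓡 4) (𝓡 4) (unitChart o p) x) * bfB.det w) := by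
  set c := unitChart o p with hc
  set f := orientedPinch o p with hf
  have hxs : x ∈ (unitChart o p).source := by rwa [unitChart_source]
  have hfx : f x = (stereo 4).symm (c x) := orientedPinch_eq_symm o p hxs hcx.le
  have htgt : c x ∈ (stereo 4).target := by rw [stereo_target]; exact mem_univ _
  -- `f = σ⁻¹ ∘ c` near `x`
  have hU : IsOpen ((unitChart o p).source ∩ unitChart o p ⁻¹' ball 0 (1 / 2)) :=
    (unitChart o p).isOpen_inter_preimage isOpen_ball
  have hev : f =ᶠ[𝓝 x] ((stereo 4).symm ∘ c) := by
    filter_upwards [hU.mem_nhds ⟨hxs, mem_ball_zero_iff.2 hcx⟩] with y hy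
    exact orientedPinch_eq_symm o p hy.1 (mem_ball_zero_iff.1 hy.2).le
  have hcd : MDifferentiableAt (𝓡 4) (𝓡 4) c x := by
    have h := (contMDiffOn_unitChart (m := ∞) o p).contMDiffAt ((unitChart o p).open_source.mem_nhds hxs)
    exact h.mdifferentiableAt (by simp)
  have hsd : MDifferentiableAt (𝓡 4) (𝓡 4) (stereo 4).symm (c x) := mdifferentiableAt_atlas_symm (stereo_mem_atlas 4) htgt
  have hmf : mfderiv (𝓡 4) (𝓡 4) f x = (mfderiv (𝓡 4) (𝓡 4) (stereo 4).symm (c x)).comp (mfderiv (𝓡 4) (𝓡 4) c x) := by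
    rw [hev.mfderiv_eq, mfderiv_comp x hsd hcd]
  have hid : (mfderiv (𝓡 4) (𝓡 4) (stereo 4) ((stereo 4).symm (c x))).comp (mfderiv (𝓡 4) (𝓡 4) (stereo 4).symm (c x)) =
      ContinuousLinearMap.id ℝ _ :=
    (mdifferentiable_of_mem_atlas (stereo_mem_atlas 4)).comp_symm_deriv htgt
  -- the chart-level determinant formula, with the model space spelled out
  have hdet : ∀ A : EuclideanSpace ℝ (Fin 4) →L[ℝ] EuclideanSpace ℝ (Fin 4),
      modelVolumeForm (fun i ↦ A (w i)) = detE A * bfB.det w := fun A ↦ by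
    rw [ContinuousAlternatingMap.apply_comp_eq_det_mul bfB modelVolumeForm A w, modelVolumeForm_eq_det]
  rw [MForm.pullback_apply]
  -- rewrite the base point `f x = σ⁻¹ (c x)` everywhere (tangent spaces are the model space)
  have key : ∀ (q : sphere (0 : EuclideanSpace ℝ (Fin 5)) 1) (A : EuclideanSpace ℝ (Fin 4) →L[ℝ] EuclideanSpace ℝ (Fin 4)),
      q = (stereo 4).symm (c x) → A = (mfderiv (𝓡 4) (𝓡 4) (stereo 4).symm (c x)).comp (mfderiv (𝓡 4) (𝓡 4) c x) →
      sphereBumpForm q (fun i ↦ A (w i)) = bumpQ (c x) * (detE (mfderiv (𝓡 4) (𝓡 4) c x) * bfB.det w) := by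
    rintro q A rfl rfl
    rw [sphereBumpForm_of_mem ((stereo 4).map_target htgt), MForm.pullback_apply, (stereo 4).right_inv htgt, modelBumpForm_apply,
      ← hdet]
    congr 1
    congr 1
    funext i
    change ((mfderiv (𝓡 4) (𝓡 4) (stereo 4) ((stereo 4).symm (c x))).comp (mfderiv (𝓡 4) (𝓡 4) (stereo 4).symm (c x)))
      (mfderiv (𝓡 4) (𝓡 4) c x (w i)) = _
    rw [hid]
    rfl
  exact key (f x) (mfderiv (𝓡 4) (𝓡 4) f x) hfx hmf

/-- **Off the half-ball the pull-back vanishes**: if not (`x` in the source and `‖c x‖ < ½`), then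
`f x` lies off the carrier of the bump form. [folklore] -/
theorem orientedPinch_not_mem_bumpCarrier {x : N}
    (h : ¬ (x ∈ (chartAt (EuclideanSpace ℝ (Fin 4)) p).source ∧ ‖unitChart o p x‖ < 1 / 2)) :
    orientedPinch o p x ∉ bumpCarrier := by
  rintro ⟨y, hy, hyx⟩
  rw [mem_closedBall_zero_iff] at hy
  have htgt : ∀ z : EuclideanSpace ℝ (Fin 4), z ∈ (stereo 4).target := fun z ↦ by rw [stereo_target]; exact mem_univ _
  by_cases hxs : x ∈ (chartAt (EuclideanSpace ℝ (Fin 4)) p).source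
  · have hxs' : x ∈ (unitChart o p).source := by rwa [unitChart_source]
    have hcx : 1 / 2 ≤ ‖unitChart o p x‖ := not_lt.1 fun hlt ↦ h ⟨hxs, hlt⟩
    by_cases h1 : ‖unitChart o p x‖ < 1
    · -- `f x = σ⁻¹ (c x / ψ(c x))` with `‖c x / ψ(c x)‖ ≥ ‖c x‖ ≥ ½ > ¼`
      have h2 : orientedPinch o p x = (stereo 4).symm ((bump 4 (unitChart o p x))⁻¹ • unitChart o p x) := by
        rw [orientedPinch, pinch_of_mem _ hxs', modelPinch_eq_symm_smul 4 h1]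
      rw [h2] at hyx
      have h3 := (stereo 4).symm.injOn (by rw [(stereo 4).symm_source]; exact htgt _)
        (by rw [(stereo 4).symm_source]; exact htgt _) hyx
      have hb : 0 < bump 4 (unitChart o p x) := bump_pos 4 h1
      have hb1 : bump 4 (unitChart o p x) ≤ 1 := (bump 4).le_one
      have h4 : ‖(bump 4 (unitChart o p x))⁻¹ • unitChart o p x‖ = (bump 4 (unitChart o p x))⁻¹ * ‖unitChart o p x‖ := by
        rw [norm_smul, norm_inv, Real.norm_eq_abs, abs_of_pos hb]
      have h5 : ‖unitChart o p x‖ ≤ (bump 4 (unitChart o p x))⁻¹ * ‖unitChart o p x‖ :=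
        le_mul_of_one_le_left (norm_nonneg _) ((one_le_inv₀ hb).2 hb1)
      rw [h3, h4] at hy
      linarith
    · push Not at h1
      have h2 : orientedPinch o p x = pole 4 := orientedPinch_eq_pole o p (Or.inr h1)
      rw [h2] at hyx
      exact symm_ne_pole 4 y hyx
  · have hxs' : x ∉ (unitChart o p).source := by rwa [unitChart_source]
    have h2 : orientedPinch o p x = pole 4 := orientedPinch_eq_pole o p (Or.inl hxs')
    rw [h2] at hyx
    exact symm_ne_pole 4 y hyx

/-- Off the half-ball the pull-back of the sphere bump form vanishes. [folklore] -/
theorem pullback_orientedPinch_sphereBumpForm_eq_zero {x : N}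
    (h : ¬ (x ∈ (chartAt (EuclideanSpace ℝ (Fin 4)) p).source ∧ ‖unitChart o p x‖ < 1 / 2)) :
    (sphereBumpForm.pullback (𝓡 4) (orientedPinch o p)) x = 0 := by
  ext w
  rw [MForm.pullback_apply, sphereBumpForm_eq_zero_of_not_mem (orientedPinch_not_mem_bumpCarrier o p h)]
  simp

/-- The pull-back of the sphere bump form is smooth. [folklore] -/
theorem isSmoothForm_pullback_sphereBumpForm [T2Space N] : IsSmoothForm (sphereBumpForm.pullback (𝓡 4) (orientedPinch o p)) := fun _ ↦
  MForm.SmoothAt.pullback (Eventually.of_forall fun z ↦ contMDiff_orientedPinch o p z) (isSmoothForm_sphereBumpForm _)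

end Pullback

/-! ### Integration against the ray orientation -/

section Integral

variable {N : Type} [TopologicalSpace N] [T2Space N] [CompactSpace N] [ChartedSpace (EuclideanSpace ℝ (Fin 4)) N]
  [IsManifold (𝓡 4) ∞ N] {v : MForm (𝓡 4) N ℝ 4} (hv : IsSmoothForm v) (hne : ∀ x, v x ≠ 0)

omit [T2Space N] [CompactSpace N] [IsManifold (𝓡 4) ∞ N] in
include hne in
/-- `v_x ≠ 0` as an alternating map. [folklore] -/
theorem toAlternatingMap_ne_zero (x : N) : (v x).toAlternatingMap ≠ 0 := fun h ↦
  hne x (ContinuousAlternatingMap.toAlternatingMap_injective (h.trans ContinuousAlternatingMap.toAlternatingMap_zero.symm))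

/-- **The pointwise ray orientation family of `v`** (the orientation used by the integral). [folklore] -/
def rayFamily (x : N) : _root_.Orientation ℝ (TangentSpace (𝓡 4) x) (Fin 4) :=
  rayOfNeZero ℝ _ (toAlternatingMap_ne_zero hne x)

omit [T2Space N] [CompactSpace N] [IsManifold (𝓡 4) ∞ N] in
/-- The chart signs of the ray family are the signs of the chart representative of `v`. [folklore] -/
theorem sign_orientationForm_rayFamily (x : N) :
    Real.sign (orientationForm (rayFamily hne) x ⇑(modelBasis (EuclideanSpace ℝ (Fin 4)) 4)) =
      Real.sign (v x ⇑(modelBasis (EuclideanSpace ℝ (Fin 4)) 4)) :=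
  sign_someVector_rayOfNeZero (v x).toAlternatingMap (toAlternatingMap_ne_zero hne x) _

omit [T2Space N] [CompactSpace N] in
include hv in
/-- **The ray family is a continuous orientation** (the chart representative of a smooth form is
continuous at the centre). [cite: LeeSmoothManifolds2013, Prop. 15.5] -/
theorem isContinuousOrientation_rayFamily : IsContinuousOrientation (rayFamily hne) := by
  set e : Module.Basis (Fin 4) ℝ (EuclideanSpace ℝ (Fin 4)) := modelBasis (EuclideanSpace ℝ (Fin 4)) 4 with he_def
  have hc : ∀ x, v x ⇑e ≠ 0 := fun x h ↦ hne x <| by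
    have h2 : (v x).toAlternatingMap = 0 := (AlternatingMap.map_basis_eq_zero_iff e (v x).toAlternatingMap).1 h
    exact ContinuousAlternatingMap.toAlternatingMap_injective (h2.trans ContinuousAlternatingMap.toAlternatingMap_zero.symm)
  have hsign : ∀ (x₀ : N) (y : EuclideanSpace ℝ (Fin 4)), chartSign (rayFamily hne) x₀ y = Real.sign (v.inChart x₀ y ⇑e) := by
    intro x₀ y
    simp only [rayFamily, chartSign]
    rw [sign_someVector_rayOfNeZero]
    rfl
  intro x₀
  have hg : ContinuousWithinAt (fun y ↦ v.inChart x₀ y ⇑e) (range (𝓡 4)) (extChartAt (𝓡 4) x₀ x₀) :=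
    (continuous_eval_const (⇑e : Fin 4 → EuclideanSpace ℝ (Fin 4))).continuousAt.comp_continuousWithinAt
      (hv x₀).continuousWithinAt
  have hg0 : v.inChart x₀ (extChartAt (𝓡 4) x₀ x₀) ⇑e ≠ 0 := by
    rw [MForm.inChart_apply_self]
    exact hc x₀
  have hev : ∀ᶠ y in 𝓝[range (𝓡 4)] (extChartAt (𝓡 4) x₀ x₀),
      0 < v.inChart x₀ y ⇑e * v.inChart x₀ (extChartAt (𝓡 4) x₀ x₀) ⇑e :=
    (hg.tendsto.mul_const _).eventually (lt_mem_nhds (mul_self_pos.2 hg0))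
  filter_upwards [hev] with y hy
  rw [hsign, hsign]
  rcases pos_and_pos_or_neg_and_neg_of_mul_pos hy with ⟨ha, hb⟩ | ⟨ha, hb⟩
  · rw [Real.sign_of_pos ha, Real.sign_of_pos hb]
    exact ⟨rfl, one_ne_zero⟩
  · rw [Real.sign_of_neg ha, Real.sign_of_neg hb]
    exact ⟨rfl, neg_ne_zero.2 one_ne_zero⟩

include hv in
/-- **`∫_{(N, o_v)} v > 0`.** [cite: LeeSmoothManifolds2013, Prop. 16.6] -/
theorem integral_self_pos [Nonempty N] : 0 < MForm.integral (rayFamily hne) v := by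
  refine MForm.integral_pos_of_sign_mul_apply_nonneg (isContinuousOrientation_rayFamily hv hne) hv (fun x ↦ ?_) ?_
  · have h := abs_nonneg (v x ⇑(modelBasis (EuclideanSpace ℝ (Fin 4)) 4))
    rw [← real_sign_mul_self, ← sign_orientationForm_rayFamily hne x] at h
    exact h
  · obtain ⟨x⟩ := ‹Nonempty N›
    refine ⟨x, ?_⟩
    have hc : v x ⇑(modelBasis (EuclideanSpace ℝ (Fin 4)) 4) ≠ 0 := fun h ↦ hne x <| by
      have h2 : (v x).toAlternatingMap = 0 :=
        (AlternatingMap.map_basis_eq_zero_iff (modelBasis (EuclideanSpace ℝ (Fin 4)) 4) (v x).toAlternatingMap).1 h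
      exact ContinuousAlternatingMap.toAlternatingMap_injective (h2.trans ContinuousAlternatingMap.toAlternatingMap_zero.symm)
    have h := abs_pos.2 hc
    rw [← real_sign_mul_self, ← sign_orientationForm_rayFamily hne x] at h
    exact h

/-- Sign bookkeeping: `sign(c d) · (b · (e · d))` is non-negative for `b ≥ 0`, `c e > 0`. [folklore] -/
theorem sign_mul_nonneg_aux {b c d e : ℝ} (hb : 0 ≤ b) (hce : 0 < c * e) (hd : d ≠ 0) :
    0 ≤ Real.sign (c * d) * (b * (e * d)) := by
  rcases mul_pos_iff.1 hce with ⟨hc, he⟩ | ⟨hc, he⟩ <;> rcases lt_or_gt_of_ne hd with hd' | hd'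
  · rw [Real.sign_of_neg (mul_neg_of_pos_of_neg hc hd')]
    nlinarith [mul_nonneg hb (neg_nonneg.2 (mul_neg_of_pos_of_neg he hd').le)]
  · rw [Real.sign_of_pos (mul_pos hc hd')]
    nlinarith [mul_nonneg hb (mul_pos he hd').le]
  · rw [Real.sign_of_pos (mul_pos_of_neg_of_neg hc hd')]
    nlinarith [mul_nonneg hb (mul_pos_of_neg_of_neg he hd').le]
  · rw [Real.sign_of_neg (mul_neg_of_neg_of_pos hc hd')]
    nlinarith [mul_nonneg hb (neg_nonneg.2 (mul_neg_of_neg_of_pos he hd').le)]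

/-- … and positive for `b > 0`. [folklore] -/
theorem sign_mul_pos_aux {b c d e : ℝ} (hb : 0 < b) (hce : 0 < c * e) (hd : d ≠ 0) :
    0 < Real.sign (c * d) * (b * (e * d)) := by
  rcases mul_pos_iff.1 hce with ⟨hc, he⟩ | ⟨hc, he⟩ <;> rcases lt_or_gt_of_ne hd with hd' | hd'
  · rw [Real.sign_of_neg (mul_neg_of_pos_of_neg hc hd')]
    nlinarith [mul_pos hb (neg_pos.2 (mul_neg_of_pos_of_neg he hd'))]
  · rw [Real.sign_of_pos (mul_pos hc hd')]
    nlinarith [mul_pos hb (mul_pos he hd')]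
  · rw [Real.sign_of_pos (mul_pos_of_neg_of_neg hc hd')]
    nlinarith [mul_pos hb (mul_pos_of_neg_of_neg he hd')]
  · rw [Real.sign_of_neg (mul_neg_of_neg_of_pos hc hd')]
    nlinarith [mul_pos hb (neg_pos.2 (mul_neg_of_neg_of_pos he hd'))]

omit [T2Space N] [CompactSpace N] in
/-- **The pull-back of the sphere bump form along the oriented pinch map of the ray orientation is
`o_v`-non-negative, positive at `p`** (pointwise, on the reference frame of the integration theory).
[cite: LeeSmoothManifolds2013, Prop. 15.6 and Prop. 16.6] -/
theorem sign_mul_pullback_sphereBumpForm_nonneg (p x : N) :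
    0 ≤ Real.sign (orientationForm (rayFamily hne) x ⇑(modelBasis (EuclideanSpace ℝ (Fin 4)) 4)) *
      (sphereBumpForm.pullback (𝓡 4) (orientedPinch (rayOrientation v hv hne) p)) x ⇑(modelBasis (EuclideanSpace ℝ (Fin 4)) 4) := by
  rw [sign_orientationForm_rayFamily hne x]
  -- generalize to model-space-typed maps (tangent spaces are the model space only up to unfolding)
  suffices key : ∀ w P : (EuclideanSpace ℝ (Fin 4)) [⋀^Fin 4]→L[ℝ] ℝ, w = v x →
      P = (sphereBumpForm.pullback (𝓡 4) (orientedPinch (rayOrientation v hv hne) p)) x →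
      0 ≤ Real.sign (w ⇑(modelBasis (EuclideanSpace ℝ (Fin 4)) 4)) * P ⇑(modelBasis (EuclideanSpace ℝ (Fin 4)) 4) from
    key _ _ rfl rfl
  intro w P hw hP
  by_cases h : x ∈ (chartAt (EuclideanSpace ℝ (Fin 4)) p).source ∧ ‖unitChart (rayOrientation v hv hne) p x‖ < 1 / 2
  · have hP' : P ⇑(modelBasis (EuclideanSpace ℝ (Fin 4)) 4) = bumpQ (unitChart (rayOrientation v hv hne) p x) *
        (detE (mfderiv (𝓡 4) (𝓡 4) (unitChart (rayOrientation v hv hne) p) x) * bfB.det ⇑(modelBasis (EuclideanSpace ℝ (Fin 4)) 4)) := by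
      rw [hP]
      exact pullback_orientedPinch_sphereBumpForm_apply (rayOrientation v hv hne) p h.1 h.2 _
    have hw' : w ⇑(modelBasis (EuclideanSpace ℝ (Fin 4)) 4) =
        AlmostComplexStructure.coeffFour w * bfB.det ⇑(modelBasis (EuclideanSpace ℝ (Fin 4)) 4) := apply_eq_coeffFour_mul w _
    have hpos : 0 < AlmostComplexStructure.coeffFour w * detE (mfderiv (𝓡 4) (𝓡 4) (unitChart (rayOrientation v hv hne) p) x) := by
      rw [hw]
      exact coeffFour_mul_det_mfderiv_unitChart_pos p hv hne h.1 (lt_trans h.2 (by norm_num))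
    rw [hP', hw']
    exact sign_mul_nonneg_aux (bumpQ_nonneg _) hpos det_modelBasis_ne_zero
  · have hP' : P = 0 := by
      rw [hP]
      exact pullback_orientedPinch_sphereBumpForm_eq_zero (rayOrientation v hv hne) p h
    rw [hP', ContinuousAlternatingMap.coe_zero, Pi.zero_apply, mul_zero]

omit [T2Space N] [CompactSpace N] in
/-- … and positive at `p`. [folklore] -/
theorem sign_mul_pullback_sphereBumpForm_pos (p : N) :
    0 < Real.sign (orientationForm (rayFamily hne) p ⇑(modelBasis (EuclideanSpace ℝ (Fin 4)) 4)) *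
      (sphereBumpForm.pullback (𝓡 4) (orientedPinch (rayOrientation v hv hne) p)) p ⇑(modelBasis (EuclideanSpace ℝ (Fin 4)) 4) := by
  rw [sign_orientationForm_rayFamily hne p]
  have hps : p ∈ (chartAt (EuclideanSpace ℝ (Fin 4)) p).source := mem_chart_source _ p
  have hcp : ‖unitChart (rayOrientation v hv hne) p p‖ < 1 / 2 := by rw [unitChart_self, norm_zero]; norm_num
  suffices key : ∀ w P : (EuclideanSpace ℝ (Fin 4)) [⋀^Fin 4]→L[ℝ] ℝ, w = v p →
      P = (sphereBumpForm.pullback (𝓡 4) (orientedPinch (rayOrientation v hv hne) p)) p →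
      0 < Real.sign (w ⇑(modelBasis (EuclideanSpace ℝ (Fin 4)) 4)) * P ⇑(modelBasis (EuclideanSpace ℝ (Fin 4)) 4) from
    key _ _ rfl rfl
  intro w P hw hP
  have hP' : P ⇑(modelBasis (EuclideanSpace ℝ (Fin 4)) 4) = bumpQ (unitChart (rayOrientation v hv hne) p p) *
      (detE (mfderiv (𝓡 4) (𝓡 4) (unitChart (rayOrientation v hv hne) p) p) * bfB.det ⇑(modelBasis (EuclideanSpace ℝ (Fin 4)) 4)) := by
    rw [hP]
    exact pullback_orientedPinch_sphereBumpForm_apply (rayOrientation v hv hne) p hps hcp _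
  rw [unitChart_self, bumpQ_zero] at hP'
  have hw' : w ⇑(modelBasis (EuclideanSpace ℝ (Fin 4)) 4) =
      AlmostComplexStructure.coeffFour w * bfB.det ⇑(modelBasis (EuclideanSpace ℝ (Fin 4)) 4) := apply_eq_coeffFour_mul w _
  have hpos : 0 < AlmostComplexStructure.coeffFour w * detE (mfderiv (𝓡 4) (𝓡 4) (unitChart (rayOrientation v hv hne) p) p) := by
    rw [hw]
    exact coeffFour_mul_det_mfderiv_unitChart_pos p hv hne hps (lt_trans hcp (by norm_num))
  rw [hP', hw']
  exact sign_mul_pos_aux one_pos hpos det_modelBasis_ne_zero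

/-- **`∫_{(N, o_v)} f^*β_S > 0`.** [cite: LeeSmoothManifolds2013, Prop. 16.6] -/
theorem integral_pullback_sphereBumpForm_pos (p : N) :
    0 < MForm.integral (rayFamily hne) (sphereBumpForm.pullback (𝓡 4) (orientedPinch (rayOrientation v hv hne) p)) :=
  MForm.integral_pos_of_sign_mul_apply_nonneg (isContinuousOrientation_rayFamily hv hne)
    (isSmoothForm_pullback_sphereBumpForm _ p) (sign_mul_pullback_sphereBumpForm_nonneg hv hne p)
    ⟨p, sign_mul_pullback_sphereBumpForm_pos hv hne p⟩

end Integral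


/-! ### The class argument: forms with positive integral pair with the same sign -/

section ClassArgument

variable {N : Type} [TopologicalSpace N] [T2Space N] [CompactSpace N] [ConnectedSpace N]
  [ChartedSpace (EuclideanSpace ℝ (Fin 4)) N] [IsManifold (𝓡 4) ∞ N]

omit [ConnectedSpace N] in
/-- The period functional is additive and homogeneous IN THE FORM. [folklore] -/
theorem periodFunctional_add_smul (α β : MForm (𝓡 4) N ℝ 4) (hα : IsSmoothForm α) (hαc : IsClosedForm α)
    (hβ : IsSmoothForm β) (hβc : IsClosedForm β) (t : ℝ) (hγ : IsSmoothForm (β + t • α)) (hγc : IsClosedForm (β + t • α))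
    (z : singularHomology ℤ ℤ N 4) :
    periodFunctional (β + t • α) hγ hγc z = periodFunctional β hβ hβc z + t * periodFunctional α hα hαc z := by
  have hs : t • α ∈ closedSmoothForms (𝓡 4) N ℝ 4 := (closedSmoothForms (𝓡 4) N ℝ 4).smul_mem t ⟨hα, hαc⟩
  simp only [periodFunctional_apply]
  rw [realClassOfClosedForm_add β (t • α) hβ hβc hs.1 hs.2, realClassOfClosedForm_smul t α hα hαc, map_add, map_smul,
    LinearMap.add_apply, LinearMap.smul_apply, smul_eq_mul]

/-- A closed smooth top form whose period on `[N]_μ` vanishes is exact (`H⁴(N; ℝ)` is detected by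
`[N] ⊗ 1`, and de Rham's map is injective). [cite: LeeSmoothManifolds2013, Thm. 17.31 and Thm. 18.14] -/
theorem mem_exactSmoothForms_of_periodFunctional_eq_zero (μ : HomologicalOrientation ℤ N 4) {γ : MForm (𝓡 4) N ℝ 4}
    (hγ : IsSmoothForm γ) (hγc : IsClosedForm γ) (h0 : periodFunctional γ hγ hγc μ.fundamentalClass = 0) :
    γ ∈ exactSmoothForms (𝓡 4) N ℝ 4 := by
  rw [periodFunctional_apply, intCastAddHom_real_eq_algebraMap] at h0
  have h1 := eq_zero_of_kroneckerPairing_coeffChange_fundamentalClass_eq_zero ℝ μ h0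
  rw [realClassOfClosedForm_eq, LinearEquiv.map_eq_zero_iff] at h1
  exact mem_exactSmoothForms_of_mk_eq_zero ⟨γ, hγ, hγc⟩ h1

/-- **Two closed smooth top forms with positive integral (for one continuous orientation family) have
periods of the same sign on any fundamental class on which one of them pairs non-trivially**:
`[β] = λ [α]` in `H⁴_dR(N) ≅ ℝ` with `λ = ∫β / ∫α > 0` (Stokes). [cite: LeeSmoothManifolds2013, Thm. 17.31]
[cite: Bredon1993, Thm. V.9.5] -/
theorem periodFunctional_mul_pos_of_integral_pos {o : (x : N) → _root_.Orientation ℝ (TangentSpace (𝓡 4) x) (Fin 4)}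
    (ho : IsContinuousOrientation o) (μ : HomologicalOrientation ℤ N 4) {α β : MForm (𝓡 4) N ℝ 4} (hα : IsSmoothForm α)
    (hαc : IsClosedForm α) (hβ : IsSmoothForm β) (hβc : IsClosedForm β)
    (hαne : periodFunctional α hα hαc μ.fundamentalClass ≠ 0) (hαi : 0 < MForm.integral o α) (hβi : 0 < MForm.integral o β) :
    0 < periodFunctional α hα hαc μ.fundamentalClass * periodFunctional β hβ hβc μ.fundamentalClass := by
  set a := periodFunctional α hα hαc μ.fundamentalClass with ha
  set b := periodFunctional β hβ hβc μ.fundamentalClass with hb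
  set t := b / a with ht
  -- `γ = β - t α` has zero period, hence is exact, hence has zero integral
  have hs : (-t) • α ∈ closedSmoothForms (𝓡 4) N ℝ 4 := (closedSmoothForms (𝓡 4) N ℝ 4).smul_mem (-t) ⟨hα, hαc⟩
  have hγm : β + (-t) • α ∈ closedSmoothForms (𝓡 4) N ℝ 4 := (closedSmoothForms (𝓡 4) N ℝ 4).add_mem ⟨hβ, hβc⟩ hs
  have hγ0 : periodFunctional (β + (-t) • α) hγm.1 hγm.2 μ.fundamentalClass = 0 := by
    rw [periodFunctional_add_smul α β hα hαc hβ hβc (-t) hγm.1 hγm.2, ← ha, ← hb, ht]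
    field_simp
    ring
  have hex := mem_exactSmoothForms_of_periodFunctional_eq_zero μ hγm.1 hγm.2 hγ0
  have hint0 : MForm.integral o (β + (-t) • α) = 0 := MForm.integral_eq_zero_of_mem_exactSmoothForms_holds o ho hex
  rw [MForm.integral_add_holds o ho hβ hs.1, MForm.integral_smul] at hint0
  -- so `∫β = t ∫α`, `t > 0`
  have htpos : 0 < t := by
    have h1 : MForm.integral o β = t * MForm.integral o α := by linarith
    by_contra hle
    push Not at hle
    have : MForm.integral o β ≤ 0 := by rw [h1]; exact mul_nonpos_of_nonpos_of_nonneg hle hαi.le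
    linarith
  rw [ht] at htpos
  rcases div_pos_iff.1 htpos with ⟨hb', ha'⟩ | ⟨hb', ha'⟩
  · exact mul_pos ha' hb'
  · exact mul_pos_of_neg_of_neg ha' hb'

end ClassArgument

/-! ### Naturality: the period of `f^*β_S` is a pairing on `S⁴` -/

section Naturality

variable {N : Type} [TopologicalSpace N] [T2Space N] [CompactSpace N] [ChartedSpace (EuclideanSpace ℝ (Fin 4)) N]
  [IsManifold (𝓡 4) ∞ N]

/-- **`P_N(f^*β_S) = ⟨e_S[β_S], f_*[N]_μ ⊗ 1⟩`** for any `C^∞` map `f : N → S⁴` (naturality of de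
Rham's isomorphism, Lee Thm. 18.14, and the Kronecker adjunction `⟨f^*a, z⟩ = ⟨a, f_*z⟩`).
[cite: LeeSmoothManifolds2013, Thm. 18.14] -/
theorem periodFunctional_pullback_eq {f : N → sphere (0 : EuclideanSpace ℝ (Fin 5)) 1} (hf : ContMDiff (𝓡 4) (𝓡 4) ∞ f)
    (hβ : IsSmoothForm (sphereBumpForm.pullback (𝓡 4) f)) (hβc : IsClosedForm (sphereBumpForm.pullback (𝓡 4) f))
    (z : singularHomology ℤ ℤ N 4) :
    periodFunctional (sphereBumpForm.pullback (𝓡 4) f) hβ hβc z =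
      kroneckerPairing ℝ ℝ (sphere (0 : EuclideanSpace ℝ (Fin 5)) 1) 4
        (realClassOfClosedForm sphereBumpForm isSmoothForm_sphereBumpForm isClosedForm_sphereBumpForm)
        (singularHomology.coeffChange (sphere (0 : EuclideanSpace ℝ (Fin 5)) 1) (Int.castAddHom ℝ) 4
          (singularHomology.map ℤ ℤ ⟨f, hf.continuous⟩ 4 z)) := by
  haveI : SecondCountableTopology N := ChartedSpace.secondCountable_of_sigmaCompact (EuclideanSpace ℝ (Fin 4)) N
  haveI : LocallyCompactSpace N := ChartedSpace.locallyCompactSpace (EuclideanSpace ℝ (Fin 4)) N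
  haveI : LocallyCompactSpace (sphere (0 : EuclideanSpace ℝ (Fin 5)) 1) :=
    ChartedSpace.locallyCompactSpace (EuclideanSpace ℝ (Fin 4)) _
  rw [periodFunctional_apply, realClassOfClosedForm_eq, realClassOfClosedForm_eq]
  have h1 : (⟨sphereBumpForm.pullback (𝓡 4) f, hβ, hβc⟩ : closedSmoothForms (𝓡 4) N ℝ 4) =
      ⟨sphereBumpForm.pullback (𝓡 4) f, pullback_mem_closedSmoothForms hf ⟨isSmoothForm_sphereBumpForm, isClosedForm_sphereBumpForm⟩⟩ :=
    rfl
  rw [h1, ← deRhamCohomology.map_mk hf ⟨sphereBumpForm, isSmoothForm_sphereBumpForm, isClosedForm_sphereBumpForm⟩,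
    integrationDeRhamIsoFamily_map_of_contMDiff hf 4, kroneckerPairing_map, singularHomology.coeffChange_map]

end Naturality

/-! ### Assembly: the sign is universal -/

section Main

/-- **The sign of the de Rham/fundamental-class pairing is universal.**  For closed connected `C^∞`
`4`-manifolds `N, N'` and nowhere-vanishing smooth `4`-forms `v, v'`, the periods
`P_N(v) = ⟨e_N[v], [N]_{μ_v} ⊗ 1⟩` and `P_{N'}(v')` on the `ℤ`-orientations attached to the ray
orientations have the same sign: `0 < P_N(v) · P_{N'}(v')`.  Proof: `P_N(v)` has the sign of
`P_N(f^*β_S)` (both forms have positive `o_v`-integral; class argument), and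
`P_N(f^*β_S) = ⟨e_S[β_S], f_*[N]_{μ_v} ⊗ 1⟩` where `f_*[N]_{μ_v} ∈ H₄(S⁴; ℤ)` is the same class for
all `(N, v)` (`map_orientedPinch_fundamentalClass_eq`: the oriented pinch map has degree one).
[cite: Bredon1993, VI.7 Thm. 7.15, V.6 and Thm. V.9.5] [cite: MilnorTDV1965, §5] [cite: LeeSmoothManifolds2013, Thm. 17.31] -/
theorem rayPeriod_mul_rayPeriod_pos (N : Type) [TopologicalSpace N] [T2Space N] [CompactSpace N] [ConnectedSpace N]
    [ChartedSpace (EuclideanSpace ℝ (Fin 4)) N] [IsManifold (𝓡 4) ∞ N] (v : MForm (𝓡 4) N ℝ 4) (hv : IsSmoothForm v)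
    (hne : ∀ x, v x ≠ 0) (N' : Type) [TopologicalSpace N'] [T2Space N'] [CompactSpace N'] [ConnectedSpace N']
    [ChartedSpace (EuclideanSpace ℝ (Fin 4)) N'] [IsManifold (𝓡 4) ∞ N'] (v' : MForm (𝓡 4) N' ℝ 4) (hv' : IsSmoothForm v')
    (hne' : ∀ x, v' x ≠ 0) :
    0 < rayPeriod v hv hne * rayPeriod v' hv' hne' := by
  obtain ⟨p⟩ := (inferInstance : Nonempty N)
  obtain ⟨p'⟩ := (inferInstance : Nonempty N')
  have hβ : IsSmoothForm (sphereBumpForm.pullback (𝓡 4) (orientedPinch (rayOrientation v hv hne) p)) :=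
    isSmoothForm_pullback_sphereBumpForm _ p
  have hβ' : IsSmoothForm (sphereBumpForm.pullback (𝓡 4) (orientedPinch (rayOrientation v' hv' hne') p')) :=
    isSmoothForm_pullback_sphereBumpForm _ p'
  -- (1) `P(v)` and `P(β)` have the same sign; likewise on `N'`
  have h1 : 0 < rayPeriod v hv hne *
      periodFunctional (sphereBumpForm.pullback (𝓡 4) (orientedPinch (rayOrientation v hv hne) p)) hβ (isClosedForm_four _)
        (rayHomologicalOrientation v hv hne).fundamentalClass :=
    periodFunctional_mul_pos_of_integral_pos (isContinuousOrientation_rayFamily hv hne) _ hv (isClosedForm_four v) hβ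
      (isClosedForm_four _) (rayPeriod_ne_zero v hv hne) (integral_self_pos hv hne) (integral_pullback_sphereBumpForm_pos hv hne p)
  have h1' : 0 < rayPeriod v' hv' hne' *
      periodFunctional (sphereBumpForm.pullback (𝓡 4) (orientedPinch (rayOrientation v' hv' hne') p')) hβ' (isClosedForm_four _)
        (rayHomologicalOrientation v' hv' hne').fundamentalClass :=
    periodFunctional_mul_pos_of_integral_pos (isContinuousOrientation_rayFamily hv' hne') _ hv' (isClosedForm_four v') hβ'
      (isClosedForm_four _) (rayPeriod_ne_zero v' hv' hne') (integral_self_pos hv' hne')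
      (integral_pullback_sphereBumpForm_pos hv' hne' p')
  -- (2) `P(β) = P(β')`: both are `⟨e_S[β_S], z ⊗ 1⟩` for the universal class `z`
  have hz : singularHomology.map ℤ ℤ ⟨orientedPinch (rayOrientation v hv hne) p, (contMDiff_orientedPinch (rayOrientation v hv hne) p).continuous⟩ 4
        (rayHomologicalOrientation v hv hne).fundamentalClass =
      singularHomology.map ℤ ℤ ⟨orientedPinch (rayOrientation v' hv' hne') p', (contMDiff_orientedPinch (rayOrientation v' hv' hne') p').continuous⟩ 4
        (rayHomologicalOrientation v' hv' hne').fundamentalClass :=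
    map_orientedPinch_fundamentalClass_eq (rayOrientation v hv hne) p four_pos (rayOrientation v' hv' hne') p'
  have h2 : periodFunctional (sphereBumpForm.pullback (𝓡 4) (orientedPinch (rayOrientation v hv hne) p)) hβ (isClosedForm_four _)
        (rayHomologicalOrientation v hv hne).fundamentalClass =
      periodFunctional (sphereBumpForm.pullback (𝓡 4) (orientedPinch (rayOrientation v' hv' hne') p')) hβ' (isClosedForm_four _)
        (rayHomologicalOrientation v' hv' hne').fundamentalClass := by
    rw [periodFunctional_pullback_eq (contMDiff_orientedPinch _ p), periodFunctional_pullback_eq (contMDiff_orientedPinch _ p'), hz]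
  -- (3) conclude
  rw [h2] at h1
  set b := periodFunctional (sphereBumpForm.pullback (𝓡 4) (orientedPinch (rayOrientation v' hv' hne') p')) hβ' (isClosedForm_four _)
    (rayHomologicalOrientation v' hv' hne').fundamentalClass with hb
  have hb0 : b ≠ 0 := by
    rintro hb0
    rw [hb0, mul_zero] at h1
    exact lt_irrefl 0 h1
  have hbb : 0 < b * b := mul_self_pos.2 hb0
  have h3 : 0 < (rayPeriod v hv hne * rayPeriod v' hv' hne') * (b * b) := by nlinarith
  exact (pos_iff_pos_of_mul_pos h3).2 hbb

open Classical in
/-- **The universal de Rham sign `ε_dR ∈ {±1}`**: `+1` if every period `P_N(v)` is positive, `-1`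
otherwise (then every period is negative, `deRhamSignFour_mul_rayPeriod_pos`). It compensates the
`Classical.choice` of the reference generator `μE 4` of `H₄(ℝ⁴ | 0; ℤ)`. [folklore] -/
def deRhamSignFour : ℤ :=
  if ∀ (N : Type) [TopologicalSpace N] [T2Space N] [CompactSpace N] [ConnectedSpace N]
      [ChartedSpace (EuclideanSpace ℝ (Fin 4)) N] [IsManifold (𝓡 4) ∞ N] (v : MForm (𝓡 4) N ℝ 4) (hv : IsSmoothForm v)
      (hne : ∀ x, v x ≠ 0), 0 < rayPeriod v hv hne
    then 1 else -1

/-- `ε_dR = ±1`. [folklore] -/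
theorem deRhamSignFour_eq_one_or_eq_neg_one : deRhamSignFour = 1 ∨ deRhamSignFour = -1 := by
  unfold deRhamSignFour
  split_ifs
  · exact Or.inl rfl
  · exact Or.inr rfl

/-- `ε_dR² = 1`. [folklore] -/
theorem deRhamSignFour_mul_self : deRhamSignFour * deRhamSignFour = 1 := by
  rcases deRhamSignFour_eq_one_or_eq_neg_one with h | h <;> rw [h] <;> norm_num

/-- **`0 < ε_dR · P_N(v)` for every closed connected `4`-manifold and nowhere-vanishing smooth
`4`-form**: the sign of the de Rham/fundamental-class pairing on the orientation of the form is the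
universal `ε_dR`. [cite: Bredon1993, VI.7 Thm. 7.15 and Thm. V.9.5] [cite: MilnorTDV1965, §5] -/
theorem deRhamSignFour_mul_rayPeriod_pos (N : Type) [TopologicalSpace N] [T2Space N] [CompactSpace N] [ConnectedSpace N]
    [ChartedSpace (EuclideanSpace ℝ (Fin 4)) N] [IsManifold (𝓡 4) ∞ N] (v : MForm (𝓡 4) N ℝ 4) (hv : IsSmoothForm v)
    (hne : ∀ x, v x ≠ 0) : 0 < (deRhamSignFour : ℝ) * rayPeriod v hv hne := by
  unfold deRhamSignFour
  split_ifs with h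
  · rw [Int.cast_one, one_mul]
    exact h N v hv hne
  · push Not at h
    obtain ⟨N₀, _, _, _, _, _, _, v₀, hv₀, hne₀, hle⟩ := h
    have hlt : rayPeriod v₀ hv₀ hne₀ < 0 := lt_of_le_of_ne hle (rayPeriod_ne_zero v₀ hv₀ hne₀)
    have hcmp := rayPeriod_mul_rayPeriod_pos N₀ v₀ hv₀ hne₀ N v hv hne
    have hneg : rayPeriod v hv hne < 0 := by
      by_contra hge
      push Not at hge
      have := mul_nonpos_of_nonpos_of_nonneg hlt.le hge
      linarith
    rw [Int.cast_neg, Int.cast_one]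
    linarith

end Main

end DeRhamSignFour

end Literature.Geometry.Manifold
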